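import Summits.ValiantsHypothesis.ValiantsHypothesis.Theorems.ImmanantSliceMonotoneRigidityGadget
import Summits.ValiantsHypothesis.ValiantsHypothesis.Theorems.StatementJunkGuardArithCircuitExistsComputesProved
import Literature.Barriers.ValiantsHypothesis.MonotoneGapPermanentProofs
import Literature.Computability.AlgebraicComplexity.ArithCircuitProofs
import Literature.Computability.AlgebraicComplexity.RazElusiveGeneralProofs

/-!
# Route ImmanantSlice — crux `MonotoneRigidity` (stmt-ValiantsHypothesis-10453), closed

`MonotoneRigidity` (the monotone shadow of conjecture CR): if the class-function slices
`d_{χ_n} = Σ_σ χ_n(σ) Π_i X_(σ i, i)`, `χ_n : S_n → ℝ≥0` constant on conjugacy classes, have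
Jerrum–Snir monotone computations (plain fan-in-two circuits over `(ℝ≥0, +, ·)`) of p-bounded size,
then for some `k` and all large `n`, `χ_n` vanishes on the derangements all of whose cycles are
longer than `k`. PROVED with `k = 0`: for a derangement `σ₀` with `χ_n(σ₀) > 0`, the
all-ones-return gadget of `ImmanantSliceMonotoneRigidityGadget.lean` (block `E`, `σ₀(E) ∩ E = ∅`,
`n ≤ 3|E|`, `exists_block`) is a MONOTONE projection (`ArithCircuit.substVC`: variables to
variables or to the constants `0, 1`) of `d_{χ_n}` onto `C W · per_r`, `r = |E|`,
`W ≥ χ_n(σ₀) > 0` (`aeval_gadgetSubst_slice`, `le_classSum`; the block exists by a maximal-cardinality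
exchange argument, `exists_block`); one more product gate by the
constant `W⁻¹` gives a monotone computation of `per_r` with at most `s(n) + 1` gates, and
Jerrum–Snir's `r (2^{r-1} − 1) ≤ prodCount` (`JerrumSnir1982_permanent_holds`, §4.3) contradicts
`s(n) ≤ n^c + c` for `n ≥ n₀(c)` (`growth`).

* `monotoneRigidity_proof : MonotoneRigidity` — the item, verbatim.

Honest framing: a NECESSARY condition for the route's conjecture CR (every nonnegative class
function positive on a derangement class has monotone-hard slices), obtained from Jerrum–Snir
1982; it neither proves nor refutes CR, and nothing here is progress on VP ≠ VNP.

## References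
* M. Jerrum, M. Snir, *Some exact complexity results for straight-line computations over
  semirings*, J. ACM 29 (1982) 874–897, §4.3. [JerrumSnir1982]
* L. G. Valiant, *Negation can be exponentially powerful*, TCS 12 (1980). [Valiant1980]
-/

set_option linter.dupNamespace false

noncomputable section

namespace Summit.ValiantsHypothesis.ValiantsHypothesis.Theorems.ImmanantSlice

open MvPolynomial Finset Equiv
open Literature.Computability.AlgebraicComplexity
open Literature.Barriers.ValiantsHypothesis
open scoped NNReal

/-! ## Circuit plumbing: projections and one scaling gate keep monotone computations -/

section Circuits

variable {σ τ : Type*}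

/-- A projection (`substVC`) of a circuit with plain sum gates has plain sum gates (the
coefficients are untouched). [folklore] -/
theorem isPlain_substVC (P : ArithCircuit ℝ≥0 σ) (s : σ → τ ⊕ ℝ≥0)
    (hP : ∀ g ∈ P.gates, ∀ args, g = ArithCircuit.Gate.sum args → ∀ a ∈ args, a.1 = 1) :
    IsPlain (P.substVC s) := by
  intro g hg
  simp only [ArithCircuit.substVC, List.mem_map] at hg
  obtain ⟨g₀, hg₀, rfl⟩ := hg
  cases g₀ with
  | sum args =>
    simp only [ArithCircuit.Gate.substVC, IsPlainGate]
    intro a ha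
    obtain ⟨b, hb, rfl⟩ := List.mem_map.1 ha
    exact hP _ hg₀ args rfl b hb
  | prod args => simp only [ArithCircuit.Gate.substVC, IsPlainGate]

/-- A projection of a fan-in-two circuit has fan-in two. [folklore] -/
theorem isFanInTwo_substVC (P : ArithCircuit ℝ≥0 σ) (s : σ → τ ⊕ ℝ≥0) (hP : P.IsFanInTwo) :
    (P.substVC s).IsFanInTwo := by
  intro g hg
  simp only [ArithCircuit.substVC, List.mem_map] at hg
  obtain ⟨g₀, hg₀, rfl⟩ := hg
  rw [ArithCircuit.Gate.fanIn_substVC]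
  exact hP g₀ hg₀

/-- Multiplying the output by a constant (one product gate with a constant operand) keeps the
circuit plain. [folklore] -/
theorem isPlain_mul_ofConst (P : ArithCircuit ℝ≥0 τ) (hP : IsPlain P) (c : ℝ≥0) :
    IsPlain (P.mul (ArithCircuit.ofConst c)) := by
  intro g hg
  simp only [ArithCircuit.mul, ArithCircuit.append, ArithCircuit.ofConst, List.map_nil,
    List.append_nil, List.mem_append, List.mem_singleton] at hg
  rcases hg with hg | rfl
  · exact hP g hg
  · simp only [IsPlainGate]

end Circuits

/-! ## Growth: `r (2^{r-1} - 1)` beats every polynomial in `n ≤ 3r` -/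

/-- For every exponent `c` there is `n₀` with `n ^ c + c + 1 < r (2^{r-1} − 1)` whenever `n₀ ≤ n ≤ 3r`.
[folklore] -/
theorem growth (c : ℕ) :
    ∃ n₀ : ℕ, ∀ n r : ℕ, n₀ ≤ n → n ≤ 3 * r → n ^ c + c + 1 < r * (2 ^ (r - 1) - 1) := by
  obtain ⟨T, hT⟩ :=
    Literature.Computability.AlgebraicComplexity.eventually_mul_pow_lt_two_pow c (4 * (3 ^ c + c + 1))
  refine ⟨3 * (T + 2), fun n r hn hr => ?_⟩
  obtain ⟨q, rfl⟩ : ∃ q, r = q + 2 := ⟨r - 2, by omega⟩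
  have hP : 1 ≤ (q + 2) ^ c := Nat.one_le_pow _ _ (by omega)
  have hX : n ^ c + c + 1 ≤ (3 ^ c + c + 1) * (q + 2) ^ c := by
    have h1 : n ^ c ≤ (3 * (q + 2)) ^ c := Nat.pow_le_pow_left hr c
    rw [mul_pow] at h1
    have h2 : c + 1 ≤ (c + 1) * (q + 2) ^ c := Nat.le_mul_of_pos_right _ hP
    calc n ^ c + c + 1 ≤ 3 ^ c * (q + 2) ^ c + (c + 1) * (q + 2) ^ c := by omega
      _ = (3 ^ c + c + 1) * (q + 2) ^ c := by ring
  have h3 := hT (q + 2) (by omega)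
  have h3' : 4 * ((3 ^ c + c + 1) * (q + 2) ^ c) < 2 ^ q * 4 := by
    rw [← mul_assoc, show (2 : ℕ) ^ q * 4 = 2 ^ (q + 2) by rw [pow_add]; norm_num]
    exact h3
  have h4 : (3 ^ c + c + 1) * (q + 2) ^ c < 2 ^ q := by omega
  have h5 : 2 ^ q ≤ 2 ^ (q + 1) - 1 := by
    have := Nat.one_le_two_pow (n := q)
    rw [pow_succ]; omega
  have h6 : 2 ^ (q + 1) - 1 ≤ (q + 2) * (2 ^ (q + 2 - 1) - 1) := by
    rw [show q + 2 - 1 = q + 1 from rfl]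
    exact Nat.le_mul_of_pos_left _ (by omega)
  omega

/-! ## A large block for every derangement -/

/-- Every derangement `β` of `Fin n` admits `E ⊆ Fin n` with `β(E) ∩ E = ∅` and `n ≤ 3 |E|`
(a block of maximal cardinality: every `y ∉ E` has `β y ∈ E` or `β⁻¹ y ∈ E`). [folklore] -/
theorem exists_block {n : ℕ} (β : Perm (Fin n)) (hβ : ∀ x, β x ≠ x) :
    ∃ E : Finset (Fin n), (∀ x ∈ E, β x ∉ E) ∧ n ≤ 3 * E.card := by
  classical
  set S : Finset (Finset (Fin n)) := Finset.univ.filter fun E => ∀ x ∈ E, β x ∉ E with hS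
  have hne : S.Nonempty := ⟨∅, by simp [hS]⟩
  obtain ⟨E, hES, hmax⟩ := Finset.exists_max_image S Finset.card hne
  have hEv : ∀ x ∈ E, β x ∉ E := (Finset.mem_filter.1 hES).2
  refine ⟨E, hEv, ?_⟩
  -- every point is in `E ∪ β(E) ∪ β⁻¹(E)`
  have hcov : ∀ y : Fin n, y ∈ E ∨ β⁻¹ y ∈ E ∨ β y ∈ E := by
    intro y
    by_contra hc
    push Not at hc
    obtain ⟨hy, hy1, hy2⟩ := hc
    have hins : insert y E ∈ S := by
      refine Finset.mem_filter.2 ⟨Finset.mem_univ _, fun x hx => ?_⟩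
      rcases Finset.mem_insert.1 hx with rfl | hx
      · rw [Finset.mem_insert, not_or]
        exact ⟨hβ _, hy2⟩
      · rw [Finset.mem_insert, not_or]
        refine ⟨fun h => hy1 ?_, hEv x hx⟩
        rw [← h]
        show β.symm (β x) ∈ E
        rw [Equiv.symm_apply_apply]; exact hx
    have := hmax _ hins
    rw [Finset.card_insert_of_notMem hy] at this
    omega
  have hsub : (Finset.univ : Finset (Fin n)) ⊆ E ∪ E.image β ∪ E.image ⇑β⁻¹ := by
    intro y _
    rcases hcov y with h | h | h
    · exact Finset.mem_union_left _ (Finset.mem_union_left _ h)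
    · refine Finset.mem_union_left _ (Finset.mem_union_right _ (Finset.mem_image.2 ⟨_, h, ?_⟩))
      simp
    · refine Finset.mem_union_right _ (Finset.mem_image.2 ⟨_, h, ?_⟩)
      simp
  calc n = (Finset.univ : Finset (Fin n)).card := (Finset.card_fin n).symm
    _ ≤ (E ∪ E.image β ∪ E.image ⇑β⁻¹).card := Finset.card_le_card hsub
    _ ≤ (E ∪ E.image β).card + (E.image ⇑β⁻¹).card := Finset.card_union_le _ _
    _ ≤ (E.card + (E.image β).card) + (E.image ⇑β⁻¹).card :=
        Nat.add_le_add_right (Finset.card_union_le _ _) _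
    _ ≤ (E.card + E.card) + E.card :=
        Nat.add_le_add (Nat.add_le_add_left Finset.card_image_le _) Finset.card_image_le
    _ = 3 * E.card := by ring


/-! ## The item -/

/-- The slice of a coefficient function, `Σ_σ χ(σ) Π_i X_(σ i, i)`, at `χ ≡ 1` on `Fin r` is the
tree's `perPoly (Fin r)`. [folklore] -/
theorem perPoly_eq_sum (R : Type*) [CommSemiring R] (r : ℕ) :
    perPoly (Fin r) R = ∑ π : Perm (Fin r), ∏ i : Fin r, X (π i, i) := rfl

/-- **Crux `MonotoneRigidity` (stmt-ValiantsHypothesis-10453), with `k = 0`.** If the slices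
`d_{χ_n}` of nonnegative class functions `χ_n` have p-bounded Jerrum–Snir monotone computations,
then for all large `n`, `χ_n` vanishes on every derangement: otherwise the all-ones-return gadget
projects `d_{χ_n}` monotonically onto a positive multiple of `per_r`, `r ≥ n/3`, contradicting
Jerrum–Snir's `r(2^{r-1} - 1)` lower bound. [cite: JerrumSnir1982, §4.3] -/
theorem monotoneRigidity_proof : Theses.ImmanantSlice.MonotoneRigidity := by
  classical
  intro χ hχ hs
  obtain ⟨s, ⟨c, hc⟩, hP⟩ := hs
  obtain ⟨n₀, hn₀⟩ := growth c
  refine ⟨0, n₀, fun n hn σ₀ hder _ => ?_⟩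
  by_contra hne
  -- a block `E` with `σ₀(E) ∩ E = ∅` and `n ≤ 3 |E|`
  obtain ⟨E, hE, hcard⟩ := exists_block σ₀ hder
  set r := E.card with hr
  let fE : Fin r ≃ {x // x ∈ E} := E.equivFin.symm
  -- the monotone computation of `d_{χ_n}`
  obtain ⟨P, hfan, hplain, hcomp, hsize⟩ := hP n
  -- the class sum `W ≥ χ(σ₀) > 0`
  set W : ℝ≥0 := ∑ τ : Perm (Fin r), χ n (gadgetPerm σ₀ E fE 1 τ) with hW
  have hWpos : W ≠ 0 := by
    intro h0
    have hle := le_classSum (β := σ₀) fE (χ n)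
    rw [← hW, h0, nonpos_iff_eq_zero] at hle
    exact hne hle
  -- the projected and rescaled circuit computes `per_r`
  set Q : ArithCircuit ℝ≥0 (Fin r × Fin r) :=
    (P.substVC (gadgetSubst σ₀ E fE)).mul (ArithCircuit.ofConst W⁻¹) with hQ
  have hQcomp : Q.Computes (perPoly (Fin r) ℝ≥0) := by
    rw [ArithCircuit.Computes, hQ, ArithCircuit.eval_mul_holds, ArithCircuit.eval_substVC, hcomp,
      aeval_gadgetSubst_slice fE hE (χ n) (hχ n), ArithCircuit.eval_ofConst, ← hW, perPoly_eq_sum,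
      mul_comm, ← mul_assoc, ← C_mul, inv_mul_cancel₀ hWpos, C_1, one_mul]
  have hQmono : IsMonotoneComputation Q (perPoly (Fin r) ℝ≥0) :=
    ⟨(isFanInTwo_substVC P _ hfan).mul (ArithCircuit.IsFanInTwo.ofConst _),
      isPlain_mul_ofConst _ (isPlain_substVC P _ hplain) _, hQcomp⟩
  have hQsize : Q.size = P.size + 1 := by
    rw [hQ, ArithCircuit.size_mul, ArithCircuit.size_substVC, ArithCircuit.size_ofConst, add_zero]
  -- Jerrum–Snir
  have hr1 : 1 ≤ r := by
    have : n₀ ≥ 1 := by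
      by_contra h0
      have := hn₀ 0 0 (by omega) (by omega)
      simp at this
    omega
  have hJS := (JerrumSnir1982_permanent_holds r hr1).1 Q hQmono
  have hlt := hn₀ n r hn hcard
  have : r * (2 ^ (r - 1) - 1) ≤ n ^ c + c + 1 :=
    calc r * (2 ^ (r - 1) - 1) ≤ prodCount Q := hJS
      _ ≤ Q.size := prodCount_le_size Q
      _ = P.size + 1 := hQsize
      _ ≤ s n + 1 := Nat.add_le_add_right hsize 1
      _ ≤ n ^ c + c + 1 := Nat.add_le_add_right (hc n) 1
  omega

end Summit.ValiantsHypothesis.ValiantsHypothesis.Theorems.ImmanantSlice
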